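import Literature.Probability.Percolation.TriApproxDomainProofs
import Literature.Probability.Percolation.TriClaim11Converse
import Literature.Probability.Percolation.ChayesLeiHex

/-!
# Route CardyBondTriangular · crux `BondTriangularCardy` (stmt-CriticalPhenomena-4664), line `birth`,
# stub `stub_discreteDomains`, part (B1): the weak boundary values `fⁱ → 0` on the open arc `Aᵢ`

Helper of the stub `stub_discreteDomains` (`Sig.discreteDomains`, reshape v3): for ANY
Chayes–Lei hexagon model `M` on the sites of `𝕋` (Chayes–Lei 2007 §2.1–2.3; for the route
`M = triBondCritical`, critical bond percolation on `𝕋`), ANY discrete approximation `G_δ` of a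
conformal rectangle `R` (`IsDiscreteApprox`), every index `i` and every point `z` of the OPEN arc
`Aᵢ` of the 3-marked Jordan domain `(Ω; a', b', c')`, there are triangles `z_δ` of `G_δ` with
centres in `Ω`, `z_δ → z`, at which the Bollobás–Riordan separating probability of the hexagon
model, `fⁱ_δ(z_δ) = P(Eⁱ_δ(z_δ))` (`clSepProb`), tends to `0` — PROVIDED the model satisfies a
one-arm bound for yellow paths (`∀ ε > 0, ∃ ρ > 0, ∃ C > 0`, a yellow path from `B(z, r₁)` to
the complement of `B(z, r₂)` has probability `≤ ε` once `C δ ≤ r₁ ≤ ρ r₂`; for `triBondCritical`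
this is the RSW input of the line, route item `BondTriangularBoxCrossing`).

This is the first estimate of the proof of Claim 23 of Bollobás–Riordan, *Percolation* (CUP 2006),
Ch. 7, p. 200 ("`f_δ³(z_δ) = P(E_δ³(z_δ)) = o(1)`", by Lemma 4), run on the Chayes–Lei
representation. The deterministic content (`clSepEvent_subset_reachable`): if a yellow path `P`
of hexagons of `G` from `A_{i+1}` to `A_{i+2}` separates the triangle `z` from the `i`-th stretch
(no chain of dual steps across bonds of `G` avoiding the bonds of `P` leads from `z` to a face at a
dart of the stretch, `Separates`), then `P` meets every set `S` of sites through which a vertex of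
`z` is joined, inside `G`, to a site `q` of the arc `Aᵢ`: otherwise such a path of sites drags a
`P`-avoiding chain of dual steps from `z` (a good face at its vertex) to the target face at `q`
(`reach_of_pathIn`, `exists_targetFace₃` — the model-free combinatorial topology of the tree's
site-percolation proof). Hence `Eⁱ(z)` forces a yellow path from a hexagon of `S` to `A_{i+1}`;
with `S` a small ball about `z` (Claim 21, `site_conn`, and (18), `arcs_close`, supply the short
path of sites to the discrete arc) and `A_{i+1}` at distance `≥ c/2` from `z`, this is a yellow arm
across an annulus, of probability `o(1)` by the arm bound (`weakBoundaryValues_of_armBound`).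

References: B. Bollobás, O. Riordan, *Percolation*, CUP 2006, Ch. 7, proof of Claim 23 p. 200,
Lemma 4 p. 166, Claim 21 p. 193, (18) p. 183; L. Chayes, H. K. Lei, Rev. Math. Phys. 19 (2007)
§2.1–2.3.
-/

noncomputable section

namespace Summit.CriticalPhenomena.CardyFormulaZ2.Theorems.BondTriangularCardyLine

open Set Filter Topology Metric MeasureTheory
open Literature.Probability.Percolation Literature.Probability.RandomPlanarGeometry
open Literature.Probability.RandomPlanarGeometry.MarkedDomain
open Literature.Probability.LatticeModels

/-! ### Yellow paths of hexagons as walks in the yellow graph -/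

/-- A `𝕋`-walk all of whose darts are yellow adjacencies joins its start to every site of its
support in the yellow graph. -/
theorem clYellowGraph_reachable_of_darts {σ : CLHexConfig} {u v : Site 2} (P : triGraph.Walk u v)
    (hdarts : ∀ d ∈ P.darts, (clYellowGraph σ).Adj d.fst d.snd) {x : Site 2} (hx : x ∈ P.support) :
    (clYellowGraph σ).Reachable x u := by
  classical
  have hedges : ∀ e ∈ P.edges, e ∈ (clYellowGraph σ).edgeSet := by
    intro e he
    rw [SimpleGraph.Walk.edges, List.mem_map] at he
    obtain ⟨d, hd, rfl⟩ := he
    rw [show d.edge = s(d.fst, d.snd) from rfl, SimpleGraph.mem_edgeSet]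
    exact hdarts d hd
  set Q := P.transfer (clYellowGraph σ) hedges with hQ
  have hxQ : x ∈ Q.support := by rw [hQ, SimpleGraph.Walk.support_transfer]; exact hx
  exact ⟨(Q.takeUntil x hxQ).reverse⟩

/-! ### The deterministic content: a separating yellow path meets every local attachment of `z` to `Aᵢ` -/

/-- **A yellow path separating `z` from the `i`-th stretch meets every attachment of `z` to
`Aᵢ`.** Let `D` be a 3-marked discrete domain, `z` a triangle of `D` with vertex `y`, and `S` a
set of sites such that `y` is joined to a site `q` of the arc `Aᵢ` by a path of sites of `D`
inside `S`. Then the separating event `Eⁱ(z)` of the hexagon model is contained in the event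
"some hexagon of `S ∩ D` is joined by a yellow path to a hexagon of `A_{i+1}`": the separating
path `P` (from the `(i+1)`-st to the `(i+2)`-nd stretch) must visit `S`, since otherwise the path
of sites drags a chain of dual steps avoiding the bonds of `P` from `z` to the target face at `q`
containing a dart of the `i`-th stretch (`reach_of_pathIn`, `exists_targetFace₃`), contradicting
the separation; and `P` joins the visited hexagon to its start on `A_{i+1}` in the yellow graph.
(Bollobás–Riordan 2006, Ch. 7, p. 200, for the Chayes–Lei representation.) -/
theorem clSepEvent_subset_reachable (D : TriMarkedDomain 3) (i : Fin 3) {z : HexVertex}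
    (hz : hexFaceVertices z ⊆ D.verts) {y : Site 2} (hy : y ∈ hexFaceVertices z) {q : Site 2}
    (hq : q ∈ D.arc i) {S : Set (Site 2)} (hpath : PathIn triGraph ((D.verts : Set (Site 2)) ∩ S) y q) :
    D.clSepEvent i z ⊆ {σ | ∃ x ∈ S, x ∈ D.verts ∧ ∃ u ∈ D.arc (i + 1), (clYellowGraph σ).Reachable x u} := by
  classical
  rintro σ ⟨du, dv, P, -, hu, -, -, -, hsupp, hdarts, hsep⟩
  by_cases hmeet : ∃ x ∈ P.support, x ∈ S
  · obtain ⟨x, hxP, hxS⟩ := hmeet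
    refine ⟨x, hxS, (hsupp x hxP).1, du.1, Finset.mem_image_of_mem _ hu, ?_⟩
    exact clYellowGraph_reachable_of_darts P hdarts hxP
  · push Not at hmeet
    exfalso
    obtain ⟨F, d, hd, -, hd1F, hd2F, hgood⟩ := D.exists_targetFace₃ hq
    have hstart : GoodFace D.verts y z := goodFace_of_subset hz hy
    have hreach := D.reach_of_pathIn {e | e ∈ P.edges} (S := S)
      (fun v hv p => not_mem_edges_of_not_mem_support P (fun hvP => hmeet v hvP hv) p) hpath hstart hgood
    exact hsep F ⟨d, hd, hd1F, hd2F⟩ hreach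

/-- **Metric form: `Eⁱ(z)` forces a yellow arm across an annulus about a nearby boundary point.**
If the vertex `y` of the triangle `z` of `D` is joined to a site of `Aᵢ` by sites of `D` within
`γ` of `δ y`, every site within `γ` of `δ y` is within `r₁` of the point `z₀`, and every site of
`A_{i+1}` is farther than `r₂` from `z₀`, then `Eⁱ(z) ⊆ {yellow path from B(z₀, r₁) to ∁B(z₀, r₂)}`. -/
theorem clSepEvent_subset_arm (D : TriMarkedDomain 3) (i : Fin 3) {z : HexVertex}
    (hz : hexFaceVertices z ⊆ D.verts) {y : Site 2} (hy : y ∈ hexFaceVertices z) {q : Site 2}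
    (hq : q ∈ D.arc i) {δ γ r₁ r₂ : ℝ} {z₀ : ℂ}
    (hpath : PathIn triGraph ((D.verts : Set (Site 2)) ∩ {v | dist (triMeshPoint δ y) (triMeshPoint δ v) < γ}) y q)
    (hball : ∀ v : Site 2, dist (triMeshPoint δ y) (triMeshPoint δ v) < γ → ‖triMeshPoint δ v - z₀‖ < r₁)
    (hfar : ∀ u ∈ D.arc (i + 1), r₂ < ‖triMeshPoint δ u - z₀‖) :
    D.clSepEvent i z ⊆ {σ | ∃ x u : Site 2, (clYellowGraph σ).Reachable x u ∧
      ‖triMeshPoint δ x - z₀‖ < r₁ ∧ r₂ < ‖triMeshPoint δ u - z₀‖} := by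
  intro σ hσ
  obtain ⟨x, hxS, -, u, hu, hreach⟩ := clSepEvent_subset_reachable D i hz hy hq hpath hσ
  exact ⟨x, u, hreach, hball x hxS, hfar u hu⟩

/-! ### The weak boundary values from the yellow one-arm bound -/

/-- **(B1) Weak boundary values of the Chayes–Lei separating probabilities from a yellow
one-arm bound.** Let `M` be a hexagon model whose yellow paths satisfy the one-arm bound: for
every `ε > 0` there are `ρ, C > 0` such that a yellow path from `B(z, r₁)` to the complement of
`B(z, r₂)` has probability `≤ ε` whenever `C δ ≤ r₁ ≤ ρ r₂` (at mesh `δ`, sites at `δ · triEmbed`).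
Then for every discrete approximation `G_δ` of a conformal rectangle `R`, every `i` and every
point `z` of the open arc `Aᵢ` of `(Ω; a', b', c')` there are triangles `z_δ` of `G_δ`, with
centres in `Ω` tending to `z`, such that `fⁱ_δ(z_δ) = P_M(Eⁱ_δ(z_δ)) → 0` as `δ → 0⁺` — the first
estimate of the proof of Claim 23 of Bollobás–Riordan (Percolation, CUP 2006, Ch. 7, p. 200) for
the Chayes–Lei representation: by `clSepEvent_subset_arm`, Claim 21 (`site_conn`) and (18)
(`arcs_close`), `Eⁱ_δ(z_δ)` forces a yellow arm from `B(z, 2γ)` to distance `c/2`, where `c` is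
the distance from `z` to the other two arcs. -/
theorem weakBoundaryValues_of_armBound :
    ∀ (M : Literature.Probability.Percolation.ChayesLeiHexPercolation),
      (∀ ε > (0 : ℝ), ∃ ρ > (0 : ℝ), ∃ C > (0 : ℝ), ∀ (δ : ℝ) (z : ℂ) (r₁ r₂ : ℝ), 0 < δ → C * δ ≤ r₁ → r₁ ≤ ρ * r₂ →
        (Literature.Probability.Percolation.clHexPercolation M).real {σ | ∃ x y : Literature.Probability.LatticeModels.Site 2,
          (Literature.Probability.Percolation.clYellowGraph σ).Reachable x y ∧
            ‖Literature.Probability.LatticeModels.triMeshPoint δ x - z‖ < r₁ ∧ r₂ < ‖Literature.Probability.LatticeModels.triMeshPoint δ y - z‖} ≤ ε) →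
      ∀ (R : Literature.Probability.RandomPlanarGeometry.ConformalRectangle) (G : ℝ → Literature.Probability.Percolation.TriMarkedDomain 4),
        Literature.Probability.Percolation.IsDiscreteApprox R G →
        ∀ (i : Fin 3), ∀ z ∈ (Literature.Probability.RandomPlanarGeometry.MarkedDomain.forgetLast R).boundary ''
            Set.Ioo ((Literature.Probability.RandomPlanarGeometry.MarkedDomain.forgetLast R).mark i)
              ((Literature.Probability.RandomPlanarGeometry.MarkedDomain.forgetLast R).nextMark i),
          ∃ zs : ℝ → Literature.Probability.LatticeModels.HexVertex,
            (∀ᶠ δ in nhdsWithin (0 : ℝ) (Set.Ioi 0), zs δ ∈ (G δ).faces ∧ (δ : ℂ) * Literature.Probability.LatticeModels.hexCenter (zs δ) ∈ R.carrier) ∧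
              Filter.Tendsto (fun δ : ℝ => (δ : ℂ) * Literature.Probability.LatticeModels.hexCenter (zs δ)) (nhdsWithin (0 : ℝ) (Set.Ioi 0)) (nhds z) ∧
                Filter.Tendsto (fun δ => (G δ).dropLast.clSepProb M i (zs δ)) (nhdsWithin (0 : ℝ) (Set.Ioi 0)) (nhds 0) := by
  intro M harm R G hG i z hz
  obtain ⟨t, ht, rfl⟩ := hz
  set T := forgetLast R with hT
  have hzcl : T.boundary t ∈ closure R.carrier := frontier_subset_closure (R.boundary_mem_frontier t)
  obtain ⟨zs, hzs, hzt⟩ := hG.exists_faces_tendsto hzcl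
  refine ⟨zs, hzs, hzt, ?_⟩
  have hzarc : T.boundary t ∈ T.arc i := ⟨t, Ioo_subset_Icc_self ht, rfl⟩
  -- the arc `A_{i+1}` stays away from `z`
  obtain ⟨c₀, hc₀, -, hfarT⟩ := T.exists_pos_forall_mem_arc_of_dist_lt i ht
  have hsucc : ∀ j : Fin 3, j + 1 ≠ j := by decide
  have hi1 : i + 1 ≠ i := hsucc i
  have hcarc : ∀ᶠ δ in 𝓝[>] (0 : ℝ), ∀ s ∈ (G δ).dropLast.arc (i + 1),
      c₀ / 2 ≤ dist (triMeshPoint δ s) (T.boundary t) := by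
    have hfar := hfarT (i + 1) hi1
    generalize hj : i + 1 = j at hfar ⊢
    fin_cases j
    · exact hG.eventually_le_dist_of_arc (i := 0) hc₀ hfar
    · exact hG.eventually_le_dist_of_arc (i := 1) hc₀ hfar
    · have h2 : ∀ w ∈ R.arc 2, c₀ ≤ dist w (T.boundary t) := fun w hw =>
        hfar w (by change w ∈ (forgetLast R).arc 2; rw [forgetLast_arc_two]; exact Or.inl hw)
      have h3 : ∀ w ∈ R.arc 3, c₀ ≤ dist w (T.boundary t) := fun w hw =>
        hfar w (by change w ∈ (forgetLast R).arc 2; rw [forgetLast_arc_two]; exact Or.inr hw)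
      filter_upwards [hG.eventually_le_dist_of_arc hc₀ h2, hG.eventually_le_dist_of_arc hc₀ h3]
        with δ e2 e3 s hs
      change s ∈ (G δ).dropLast.arc 2 at hs
      rw [TriMarkedDomainLemmas.dropLast_arc_two, Finset.mem_union] at hs
      rcases hs with hs | hs
      · exact e2 s hs
      · exact e3 s hs
  obtain ⟨ε, hε, harcs⟩ := hG.arcs_close
  set c : ℝ := c₀ / 2 with hcdef
  have hc : 0 < c := by positivity
  -- the estimate: eventually `fⁱ(z_δ) ≤ ε'`
  rw [Metric.tendsto_nhds]
  intro ε' hε'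
  obtain ⟨ρ, hρ, C, hC, hbound⟩ := harm (ε' / 2) (half_pos hε')
  -- the radius of the small ball: `r₁ = 2γ ≤ ρ (c/2)`, `2γ ≤ c/4`
  set γ : ℝ := min (ρ * (c / 2) / 2) (c / 8) with hγdef
  have hγ : 0 < γ := by positivity
  have hγρ : 2 * γ ≤ ρ * (c / 2) := by
    have := min_le_left (ρ * (c / 2) / 2) (c / 8); rw [← hγdef] at this; linarith
  have hγc : 2 * γ ≤ c / 4 := by
    have := min_le_right (ρ * (c / 2) / 2) (c / 8); rw [← hγdef] at this; linarith
  obtain ⟨η, hη, hconn⟩ := hG.site_conn γ hγ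
  -- thresholds
  have hzt' : ∀ᶠ δ : ℝ in 𝓝[>] (0 : ℝ), dist ((δ : ℂ) * hexCenter (zs δ)) (T.boundary t) < min (η / 4) (γ / 4) :=
    (Metric.tendsto_nhds.1 hzt) _ (by positivity)
  have hεsmall : ∀ᶠ δ in 𝓝[>] (0 : ℝ), ε δ < min (η / 4) (γ / 4) :=
    hε.eventually (Iio_mem_nhds (by positivity))
  have hδsmall : ∀ᶠ δ in 𝓝[>] (0 : ℝ), δ ∈ Ioo 0 (min (min (η / 4) (γ / 4)) (2 * γ / C)) :=
    Ioo_mem_nhdsGT (by positivity)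
  filter_upwards [hzs, hcarc, harcs, hzt', hεsmall, hδsmall, hconn] with δ hzsδ hcarcδ harcsδ hztδ hεδ hδ hconnδ
  obtain ⟨hδ0, hδlt⟩ := hδ
  have hδη : δ < η / 4 := hδlt.trans_le ((min_le_left _ _).trans (min_le_left _ _))
  have hδγ : δ < γ / 4 := hδlt.trans_le ((min_le_left _ _).trans (min_le_right _ _))
  have hδC : C * δ ≤ 2 * γ := by
    have h := hδlt.trans_le (min_le_right _ _)
    rw [lt_div_iff₀ hC] at h
    linarith
  have hztη : dist ((δ : ℂ) * hexCenter (zs δ)) (T.boundary t) < η / 4 := hztδ.trans_le (min_le_left _ _)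
  have hztγ : dist ((δ : ℂ) * hexCenter (zs δ)) (T.boundary t) < γ / 4 := hztδ.trans_le (min_le_right _ _)
  have hεη : ε δ < η / 4 := hεδ.trans_le (min_le_left _ _)
  have hεγ : ε δ < γ / 4 := hεδ.trans_le (min_le_right _ _)
  rw [Real.dist_eq, sub_zero]
  -- the triangle `z_δ`, a vertex `y` of it, and a nearby site `q` of the discrete arc `Aᵢ`
  set D := (G δ).dropLast with hD
  have hzv : hexFaceVertices (zs δ) ⊆ D.verts := ((G δ).mem_faces).1 hzsδ.1
  obtain ⟨y, hy⟩ : (hexFaceVertices (zs δ)).Nonempty := by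
    rw [← Finset.card_pos, card_hexFaceVertices]; norm_num
  have hyc : dist (triMeshPoint δ y) ((δ : ℂ) * hexCenter (zs δ)) ≤ δ := by
    have := dist_triMeshPoint_hexCenter_le hy δ
    rwa [abs_of_pos hδ0] at this
  obtain ⟨q, hq, hqz⟩ := exists_mem_dropLast_arc_of_arcs_close harcsδ i hzarc
  -- the short path of sites from `y` to `q` (Claim 21)
  have hyq : dist (triMeshPoint δ y) (triMeshPoint δ q) < η := by
    have h1 := dist_triangle4 (triMeshPoint δ y) ((δ : ℂ) * hexCenter (zs δ)) (T.boundary t) (triMeshPoint δ q)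
    rw [dist_comm (T.boundary t) (triMeshPoint δ q)] at h1
    linarith
  have hpath := hconnδ y (hzv hy) q (D.arc_subset_verts i hq) hyq
  -- every site of the ball `B(δ y, γ)` is within `2γ` of `z`; `A_{i+1}` is farther than `c/2`
  have hball : ∀ v : Site 2, dist (triMeshPoint δ y) (triMeshPoint δ v) < γ →
      ‖triMeshPoint δ v - T.boundary t‖ < 2 * γ := by
    intro v hv
    rw [← dist_eq_norm]
    have h1 := dist_triangle4 (triMeshPoint δ v) (triMeshPoint δ y) ((δ : ℂ) * hexCenter (zs δ)) (T.boundary t)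
    rw [dist_comm (triMeshPoint δ v) (triMeshPoint δ y)] at h1
    linarith
  have hfar : ∀ u ∈ D.arc (i + 1), c / 2 < ‖triMeshPoint δ u - T.boundary t‖ := by
    intro u hu
    rw [← dist_eq_norm]
    have := hcarcδ u hu
    rw [hcdef]; linarith
  have hsub := clSepEvent_subset_arm D i hzv hy hq hpath hball hfar
  have hle : D.clSepProb M i (zs δ) ≤ ε' / 2 :=
    (measureReal_mono hsub (measure_ne_top _ _)).trans (hbound δ (T.boundary t) (2 * γ) (c / 2) hδ0 hδC hγρ)
  have hnn : 0 ≤ D.clSepProb M i (zs δ) := measureReal_nonneg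
  rw [abs_of_nonneg hnn]
  linarith

end Summit.CriticalPhenomena.CardyFormulaZ2.Theorems.BondTriangularCardyLine

end
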